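import Literature.Computability.Cryptography.LWEPrimePowerProgOut
import Literature.Computability.Cryptography.LWEPrimePowerProgHistBridge
import Literature.Computability.Cryptography.LWEPrimePowerProgEstBridge
import Literature.Computability.Cryptography.LWEPrimePowerLift
import HarnessLib

/-!
# The Micciancio–Peikert machine, VII′: the list-level output IS the solver's output

Topic `Computability/Cryptography` (LWE), grouping namespace `LWE.MP12.Prog`, bridge between
`LWEPrimePowerProgOut.lean` (`outOfL`) and `LWEPrimePowerStrategy.outOf` with the top solver
`LWEPrimePowerLift.topSolve`. Proved material (no named fact) towards
`Literature.Computability.Cryptography.blprs_gapSVP_sqrt_dim_to_lwe_classical` (**pqc.S21**),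
hypothesis `h₂`: **`outOfL_eq`** — on a genuine input, the list-level output is the list of
representatives of `outOf (1/G) (topSolve e) (layout (S, coins)) history`, with the empty trailer of
the secret code (the lifting loop on bit lists IS `liftUpTo`, `liftAllL_eq`; the rounded equations are
`topEqs`, `rValsL_eq`; the `GF(2)` systems are `augRows`, `augRowsL_eq`).

## References

* D. Micciancio, C. Peikert, *Trapdoors for lattices: simpler, tighter, faster, smaller*, EUROCRYPT 2012,
  LNCS 7237; full version IACR ePrint 2011/501, §3, Thm. 3.1 proof (p. 16). [MicciancioPeikert2012]
-/

noncomputable section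

namespace Literature.Computability.Cryptography

namespace LWE

namespace MP12

namespace Prog

open _root_.Computability Literature.Computability.Complexity Literature.Computability.Complexity.GF2Kernel Finset

/-! ### List lemmas -/

section Lists

variable {α : Type}

/-- All entries are `true` iff the count of `true` is the length. [folklore] -/
theorem countTrue_eq_length_iff (l : List Bool) : countTrue l = l.length ↔ ∀ b ∈ l, b = true := by
  rw [countTrue_eq, List.count_eq_length]
  exact ⟨fun h b hb => (h b hb).symm, fun h b hb => (h b hb).symm⟩

/-- `dotMod` of two `List.ofFn` is the dot product mod `Q`. [folklore] -/
theorem dotMod_ofFn {n Q : ℕ} (hQ : 1 ≤ Q) (u v : Fin n → ℕ) :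
    dotMod Q (List.ofFn u) (List.ofFn v) = (∑ i, u i * v i) % Q := by
  rw [dotMod_eq hQ, zipWith_ofFn, List.sum_ofFn]

end Lists

/-! ### The pieces -/

section Bridge

variable {d e K' m N T N' m' ℓ G : ℕ}
variable (S : Fin (numSamples d e K' m N T N' m') → (Fin d → ZMod (2 ^ e)) × ZMod (2 ^ e)) (coins : Fin (numCoins d e m N T N' ℓ) → Bool)
  (bits : List Bool)

/-- The seven unary copies of the genuine input. [folklore] -/
def Uof7 (d e K' m N T N' : ℕ) : ℕ × (ℕ × (ℕ × (ℕ × (ℕ × (ℕ × ℕ))))) := (d, (K' + 1, (e, (m, (T, (N, N'))))))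

/-- The genuine output context. [folklore] -/
def oCtxOf : OCtx := ((Pof d e K' m N T N' m' ℓ G, Uof7 d e K' m N T N'), (List.ofFn fun i => toItem (S i), bits))

variable {S coins bits}

/-- The top samples of the layout. [folklore] -/
abbrev Stop : Fin m' → (Fin d → ZMod (2 ^ e)) × ZMod (2 ^ e) := (layout d e K' m N T N' m' ℓ (S, coins)).2.2

/-- **The top slice of the item list is the list of the top samples.** [folklore] -/
theorem top_eq : sliceAt (List.ofFn fun i => toItem (S i)) (nEs e K' m N' + 2 * nXs d e K' m N T) m' = List.ofFn fun k => toItem (Stop (S := S) (coins := coins) k) := by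
  rw [sliceAt_ofFn _ _ _ (by unfold numSamples; omega)]
  congr 1
  funext k
  rw [Stop, layout_top]
  congr 2
  exact Fin.ext (by simp; omega)

/-- The rows mod `2` of the top items are `Abit`. [folklore] -/
theorem abitL_eq (St : Fin m' → (Fin d → ZMod (2 ^ e)) × ZMod (2 ^ e)) :
    abitL (List.ofFn fun k => toItem (St k)) = List.ofFn fun i => List.ofFn (Abit St i) := by
  rw [abitL, List.map_ofFn]
  congr 1
  funext i
  simp only [Function.comp_apply, toItem, List.map_ofFn]
  rfl

/-- **The augmented rows on lists are `augRows`.** [folklore] -/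
theorem augRowsL_eq (A : Fin m' → Fin d → Bool) (b : Fin m' → Bool) (j : Fin d) :
    augRowsL (List.ofFn fun i => List.ofFn (A i)) (List.ofFn b) j.val d = List.ofFn fun i => List.ofFn (augRows A b j i) := by
  rw [augRowsL, zipWith_ofFn, map_range_eq_ofFn, List.ofFn_succ', List.concat_eq_append]
  congr 1
  · congr 1
    funext i
    rw [augRows, Fin.snoc_castSucc, List.ofFn_succ', List.concat_eq_append]
    simp
  · rw [augRows, Fin.snoc_last, List.ofFn_succ', List.concat_eq_append]
    simp [Fin.ext_iff]

/-- **The residual bits on lists are `resid`.** [folklore] -/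
theorem residL_eq (St : Fin m' → (Fin d → ZMod (2 ^ e)) × ZMod (2 ^ e)) (r' : Fin m' → ℕ) {K j : ℕ} (hK : 1 ≤ K) (tacc : Fin d → ℕ) :
    residL K (2 ^ j) (List.ofFn fun k => toItem (St k)) (List.ofFn r') (List.ofFn tacc) = List.ofFn (resid St r' K j tacc) := by
  rw [residL, zipWith_ofFn]
  congr 1
  funext i
  rw [resid, Nat.max_eq_left (Nat.two_pow_pos j)]
  congr 2
  simp only [toItem]
  rw [dotMod_ofFn hK, Nat.add_sub_assoc (Nat.mod_lt _ hK).le]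
  rfl

/-- **The lifting loop on bit lists IS `liftUpTo`**: after `j` steps the state is the list of the binary
digit lists (length `j`) of `liftUpTo … j`. [cite: MicciancioPeikert2012, Thm. 3.1 proof (p. 16)] -/
theorem liftAllL_eq (St : Fin m' → (Fin d → ZMod (2 ^ e)) × ZMod (2 ^ e)) (r' : Fin m' → ℕ) {steps : ℕ} (hsteps : steps ≤ e) :
    ∀ j ≤ steps, ∃ bl : Fin d → List Bool,
      liftAllL ((d, (e, 2 ^ steps)), (List.ofFn fun k => toItem (St k), (List.ofFn fun i => List.ofFn (Abit St i), List.ofFn r'))) (List.range j) =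
        List.ofFn bl ∧ (∀ c, (bl c).length = j) ∧ ∀ c, bitsToNat (bl c) = liftUpTo St r' (2 ^ steps) j c
  | 0, _ => ⟨fun _ => [], by simp [liftAllL, List.ofFn_const], fun _ => rfl, fun _ => rfl⟩
  | j + 1, hj => by
    obtain ⟨bl, h1, h2, h3⟩ := liftAllL_eq St r' hsteps j (Nat.le_of_succ_le hj)
    have hK : 1 ≤ 2 ^ steps := Nat.two_pow_pos steps
    -- one more step
    set sol : Fin d → Bool := gf2Solve (Abit St) (resid St r' (2 ^ steps) j (liftUpTo St r' (2 ^ steps) j)) with hsol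
    refine ⟨fun c => bl c ++ [sol c], ?_, fun c => by rw [List.length_append, h2 c, List.length_singleton], fun c => ?_⟩
    · rw [liftAllL, List.range_succ, List.foldl_append, List.foldl_cons, List.foldl_nil, ← liftAllL, h1]
      simp only [liftStepL, Nat.min_eq_left (show j ≤ e by omega)]
      have htacc : (List.ofFn bl).map bitsToNat = List.ofFn (liftUpTo St r' (2 ^ steps) j) := by
        rw [List.map_ofFn]; congr 1; funext c; exact h3 c
      rw [htacc, residL_eq St r' hK, map_range_eq_ofFn, zipWith_ofFn]
      congr 1
      funext c
      rw [augRowsL_eq, hsol, gf2Solve, gf2SolveBit]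
    · rw [bitsToNat_append_singleton, h3 c, h2 c, liftUpTo, liftStep, hsol]
      ring

/-- **The rounded top equations on lists are `topEqs`.** [cite: MicciancioPeikert2012, Thm. 3.1 proof (p. 16)] -/
theorem rValsL_eq (St : Fin m' → (Fin d → ZMod (2 ^ e)) × ZMod (2 ^ e)) (sLowN : Fin d → ℕ) (a : ℕ) :
    rValsL (2 ^ e) (2 ^ a) (List.ofFn fun k => toItem (St k)) (List.ofFn sLowN) =
      List.ofFn fun k => (topEqs (p := 2) a St (fun c => ((sLowN c : ℕ) : ZMod (2 ^ e))) k).val := by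
  haveI : NeZero (2 ^ e) := ⟨(Nat.two_pow_pos e).ne'⟩
  have hQ1 : 1 ≤ 2 ^ e := Nat.two_pow_pos e
  rw [rValsL, List.map_ofFn]
  congr 1
  funext k
  simp only [Function.comp_apply, Nat.max_eq_left hQ1, topEqs, roundMul, ZMod.val_natCast, roundMulN]
  congr 4
  -- the inner representative is that of `b - ⟨a, sLow⟩`
  refine eq_val_of_cast_eq (Nat.mod_lt _ (Nat.two_pow_pos e)) ?_
  simp only [toItem]
  rw [dotMod_ofFn hQ1, ZMod.natCast_mod, Nat.cast_add, ZMod.natCast_zmod_val, cast_sub_mod, Nat.cast_sum, dotProduct, sub_eq_add_neg]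
  congr 2
  exact Finset.sum_congr rfl fun c _ => by rw [Nat.cast_mul, ZMod.natCast_zmod_val]

/-- **The top solver on lists is `topSolve`.** [cite: MicciancioPeikert2012, Thm. 3.1 proof (p. 16)] -/
theorem topSolveL_eq (St : Fin m' → (Fin d → ZMod (2 ^ e)) × ZMod (2 ^ e)) (r : Fin m' → ZMod (2 ^ e)) {a : ℕ} (ha : a ≤ e) :
    topSolveL (2 ^ e) d e a e (List.ofFn fun k => toItem (St k)) (List.ofFn fun k => (r k).val) = List.ofFn fun c => (topSolve e a St r c).val := by
  classical
  haveI : NeZero (2 ^ e) := ⟨(Nat.two_pow_pos e).ne'⟩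
  have hQ1 : 1 ≤ 2 ^ e := Nat.two_pow_pos e
  simp only [topSolveL, topSolve, Nat.min_eq_left ha, Nat.min_eq_left (Nat.sub_le e a), Nat.max_eq_left hQ1]
  have hdiv : (countTrue ((List.ofFn fun k => (r k).val).map fun v => decide (v % 2 ^ a = 0)) = (List.ofFn fun k => (r k).val).length) ↔
      ∀ i, 2 ^ a ∣ (r i).val := by
    have hl : (List.ofFn fun k => (r k).val).length = ((List.ofFn fun k => (r k).val).map fun v => decide (v % 2 ^ a = 0)).length := by simp
    rw [hl, countTrue_eq_length_iff]
    simp only [List.map_ofFn, List.forall_mem_ofFn_iff, Function.comp_apply, decide_eq_true_eq]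
    exact forall_congr' fun i => by rw [Nat.dvd_iff_mod_eq_zero]
  by_cases h : ∀ i, 2 ^ a ∣ (r i).val
  · rw [if_pos (decide_eq_true (hdiv.2 h)), if_pos h, abitL_eq, List.map_ofFn]
    obtain ⟨bl, h1, -, h3⟩ := liftAllL_eq St (fun i => (r i).val / 2 ^ a) (Nat.sub_le e a) (e - a) le_rfl
    rw [show (List.ofFn ((fun v => v / 2 ^ a) ∘ fun k => (r k).val)) = List.ofFn fun i => (r i).val / 2 ^ a from rfl, h1, List.map_ofFn]
    congr 1
    funext c
    simp only [Function.comp_apply, h3 c, ZMod.val_natCast]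
  · rw [if_neg (by rw [decide_eq_true_eq]; exact fun h' => h (hdiv.1 h')), if_neg h]
    rw [show (List.ofFn fun c : Fin d => ((0 : Fin d → ZMod (2 ^ e)) c).val) = List.ofFn fun _ : Fin d => (0 : ℕ) from by simp, List.ofFn_const]

/-- **The list-level output is the solver's output** (secret representatives, empty trailer).
[cite: MicciancioPeikert2012, Thm. 3.1 proof (p. 16)] -/
theorem outOfL_eq (hG : 1 ≤ G) :
    outOfL (oCtxOf (ℓ := ℓ) (G := G) S bits) =
      (List.ofFn fun c => (outOf (K' := K') (1 / (G : ℝ)) (fun a => topSolve (m' := m') (d := d) e a)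
        (layout d e K' m N T N' m' ℓ (S, coins)) bits c).val, []) := by
  haveI : NeZero (2 ^ e) := ⟨(Nat.two_pow_pos e).ne'⟩
  have hQ1 : 1 ≤ 2 ^ e := Nat.two_pow_pos e
  set i₀ := stepOf e N' bits with hi₀
  set a := e - i₀ with ha
  have hae : a ≤ e := Nat.sub_le e i₀
  set sLowN : Fin d → ℕ := fun c => Lstate (p := 2) (e := e) (N := N) (T := T) (N' := N') (1 / (G : ℝ)) bits c a with hsLowN
  -- the list-level pieces
  have hstep : stepOfL bits e N' = i₀ := stepOfL_eq e N' bits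
  have hsLow : (List.range d).map (fun c => LstateL bits (Hof e T N N' G) T e c a) = List.ofFn sLowN := by
    rw [map_range_eq_ofFn]; congr 1; funext c; exact LstateL_eq (T := T) (N := N) (N' := N') bits hG c a
  have htop := top_eq (S := S) (coins := coins) (K' := K') (m := m) (N := N) (T := T) (N' := N') (m' := m') (ℓ := ℓ)
  refine Prod.ext ?_ rfl
  show List.zipWith (fun s f => (s + f) % max (2 ^ e) 1) ((List.range d).map fun c => LstateL bits (Hof e T N N' G) T e c (e - stepOfL bits e N'))
    (topSolveL (2 ^ e) d e (e - stepOfL bits e N') e (sliceAt (List.ofFn fun i => toItem (S i)) (nEs e K' m N' + 2 * nXs d e K' m N T) m')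
      (rValsL (2 ^ e) (2 ^ min (e - stepOfL bits e N') e) (sliceAt (List.ofFn fun i => toItem (S i)) (nEs e K' m N' + 2 * nXs d e K' m N T) m')
        ((List.range d).map fun c => LstateL bits (Hof e T N N' G) T e c (e - stepOfL bits e N')))) = _
  rw [hstep, ← ha, hsLow, htop, Nat.min_eq_left hae, rValsL_eq, topSolveL_eq _ _ hae, zipWith_ofFn, Nat.max_eq_left hQ1]
  congr 1
  funext c
  rw [outOf, ← hi₀, ← ha, recoverTop, Pi.add_apply, ZMod.val_add, ZMod.val_natCast, Nat.mod_add_mod]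

end Bridge

end Prog

end MP12

end LWE

end Literature.Computability.Cryptography

end
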